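import Mathlib
import Literature.Computability.Complexity.Circuit
import Literature.Computability.Complexity.KWProtocol
import Literature.Computability.Complexity.KWProtocolBounds

/-!
# Crux `ShallowShadows.ShadowFormulaTransfer` (stmt-ValiantsHypothesis-17124), line `det-kw` —
# the two degenerate regimes of the registered stub `stub_detProtocol`

`stub_detProtocol` (the line's load-bearing, conjecture-grade stub) asks, uniformly in the
instance, for a Karchmer–Wigderson protocol tree `P : KWTree ι` solving the MONOTONE KW game of
the shadow `a ↦ [∃ mo ∈ supp g, supp mo ⊆ a]` of a `0/1`-coefficient polynomial `g` with an affine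
determinantal representation of size `m`, of depth `≤ (deg g)^(1-δ) · (log(m + #ι + 2))^C + C`.

This file lands, sorry-free and for EVERY polynomial `g` over any commutative semiring (no
determinant, no `0/1` hypothesis needed), the two trivial protocols that settle the stub OUTSIDE
its window:

* `exists_kwTree_shadow_width` — Alice names the support of her monomial as a `deg g`-tuple over
  the `#ι + 1` symbols "variable / blank", Bob names a variable of it missing from his set:
  depth `≤ k + t` whenever `(#ι + 1)^(deg g) ≤ 2^k` and `#ι ≤ 2^t`; in closed form
  (`exists_kwTree_shadow`) depth `≤ deg g · ⌈log₂(#ι + 1)⌉ + ⌈log₂ #ι⌉` — this is the regime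
  `deg g ≤ polylog(m + #ι)` of the stub;
* `exists_kwTree_shadow_card` — Alice sends her whole set, Bob names a variable (the shadow is
  monotone, `shadow_monotone`): depth `≤ #ι + ⌈log₂ #ι⌉` — the regime `(deg g)^(1-δ) ≥ #ι + log #ι`
  (high degree, few variables).

What remains of `stub_detProtocol` after this file is exactly the WINDOW
`polylog(m + #ι) < deg g < (#ι)^(1/(1-δ))`, where a proof must use `HasDetRepr g m` and the `0/1`
hypothesis jointly (the crux relocated onto one matrix; see `Cruxes/ShadowFormulaTransfer/
STRATEGY-CENSUS.md` §S-d and the lead's NOTES `## Census`).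

References: M. Karchmer, A. Wigderson, SIAM J. Discrete Math. 3 (1990), §2 (the DNF upper bound
for the monotone game); S. Jukna, *Boolean Function Complexity* (2012), §3.3. The protocols are
`Literature.Computability.Complexity.KWTree.exists_solvesMono_of_narrow_terms` /
`exists_solvesMono_of_monotone` (tree, `KWProtocolBounds.lean`).
-/

-- Sub = Summit single-conjunct layout: the duplicated namespace component is mandated by the tree.
set_option linter.dupNamespace false

noncomputable section

namespace Summit.ValiantsHypothesis.ValiantsHypothesis.Theorems.ShallowShadowsShadowFormulaTransfer

open Literature.Computability.Complexity

variable {ι : Type} {R : Type*} [CommSemiring R]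

/-! ### The shadow as a monotone DNF -/

/-- The shadow `a ↦ [∃ mo ∈ supp g, supp mo ⊆ a]` of a polynomial is the disjunction, over the
supports `T` of its monomials, of the terms `⋀_{i ∈ T} x_i`. [folklore] -/
theorem shadow_eq_true_iff (g : MvPolynomial ι R) (a : ι → Bool) :
    decide (∃ mo ∈ g.support, ∀ i ∈ mo.support, a i = true) = true ↔
      ∃ T ∈ ((fun mo : ι →₀ ℕ => mo.support) '' (g.support : Set (ι →₀ ℕ))),
        ∀ i ∈ T, a i = true := by
  rw [decide_eq_true_iff]
  constructor
  · rintro ⟨mo, hmo, h⟩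
    exact ⟨mo.support, ⟨mo, hmo, rfl⟩, h⟩
  · rintro ⟨T, ⟨mo, hmo, rfl⟩, h⟩
    exact ⟨mo, hmo, h⟩

/-- The shadow of a polynomial is a monotone Boolean function. [folklore] -/
theorem shadow_monotone (g : MvPolynomial ι R) :
    Monotone fun a : ι → Bool => decide (∃ mo ∈ g.support, ∀ i ∈ mo.support, a i = true) := by
  intro a b hab
  change decide _ ≤ decide _
  rw [Bool.le_iff_imp, decide_eq_true_iff, decide_eq_true_iff]
  rintro ⟨mo, hmo, h⟩
  exact ⟨mo, hmo, fun i hi => Bool.le_iff_imp.mp (hab i) (h i hi)⟩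

/-- A monomial of `g` involves at most `deg g` variables. [folklore] -/
theorem card_support_le_totalDegree (g : MvPolynomial ι R) {mo : ι →₀ ℕ}
    (hmo : mo ∈ g.support) : mo.support.card ≤ g.totalDegree := by
  calc mo.support.card = ∑ i ∈ mo.support, 1 := by simp
    _ ≤ ∑ i ∈ mo.support, mo i :=
        Finset.sum_le_sum fun i hi => Nat.one_le_iff_ne_zero.mpr (Finsupp.mem_support_iff.mp hi)
    _ = mo.sum (fun _ e => e) := rfl
    _ ≤ g.totalDegree := MvPolynomial.le_totalDegree hmo

/-! ### Regime 1: low degree — Alice names her monomial -/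

/-- **Width protocol for the shadow** (the regime `deg ≤ polylog` of `stub_detProtocol`): for
every polynomial `g` on a nonempty finite variable set of size `N`, if `(N+1)^(deg g) ≤ 2^k` and
`N ≤ 2^t` then the monotone KW game of the shadow of `g` has a protocol of depth `≤ k + t`
(Alice names the support of a monomial inside her set as a `deg g`-tuple over `N + 1` symbols,
Bob names a variable of it outside his set). No determinant and no `0/1` hypothesis is used.
[cite: KarchmerWigderson1990, §2] -/
theorem exists_kwTree_shadow_width [Fintype ι] [Nonempty ι] (g : MvPolynomial ι R) (k t : ℕ)
    (hk : (Fintype.card ι + 1) ^ g.totalDegree ≤ 2 ^ k) (ht : Fintype.card ι ≤ 2 ^ t) :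
    ∃ P : KWTree ι,
      P.SolvesMono (fun a : ι → Bool => decide (∃ mo ∈ g.support, ∀ i ∈ mo.support, a i = true)) ∧
      P.depth ≤ k + t :=
  KWTree.exists_solvesMono_of_narrow_terms
    ((fun mo : ι →₀ ℕ => mo.support) '' (g.support : Set (ι →₀ ℕ))) _ (shadow_eq_true_iff g)
    g.totalDegree k t
    (by
      rintro T ⟨mo, hmo, rfl⟩
      exact card_support_le_totalDegree g (Finset.mem_coe.mp hmo))
    hk ht

/-! ### Regime 2: few variables — Alice sends her set -/

/-- **Send-your-input protocol for the shadow** (the regime `deg^(1-δ) ≥ N + log N` of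
`stub_detProtocol`): for every polynomial `g` on a nonempty finite variable set of size `N ≤ 2^t`
the monotone KW game of its (monotone) shadow has a protocol of depth `≤ N + t`.
[cite: KarchmerWigderson1990, §2] -/
theorem exists_kwTree_shadow_card [Fintype ι] [Nonempty ι] (g : MvPolynomial ι R) (t : ℕ)
    (ht : Fintype.card ι ≤ 2 ^ t) :
    ∃ P : KWTree ι,
      P.SolvesMono (fun a : ι → Bool => decide (∃ mo ∈ g.support, ∀ i ∈ mo.support, a i = true)) ∧
      P.depth ≤ Fintype.card ι + t :=
  KWTree.exists_solvesMono_of_monotone _ (shadow_monotone g) t ht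

/-! ### Closed form -/

/-- `(N+1)^d ≤ 2^(d ⌈log₂(N+1)⌉)`. [folklore] -/
theorem pow_le_two_pow_mul_clog (N d : ℕ) : (N + 1) ^ d ≤ 2 ^ (d * Nat.clog 2 (N + 1)) := by
  calc (N + 1) ^ d ≤ (2 ^ Nat.clog 2 (N + 1)) ^ d :=
        Nat.pow_le_pow_left (Nat.le_pow_clog (by norm_num) _) d
    _ = 2 ^ (d * Nat.clog 2 (N + 1)) := by rw [← pow_mul, mul_comm]

/-- **The trivial depth bound for the shadow of any polynomial**, closed form: with
`N = #ι ≥ 1` and `d = deg g`, the monotone KW game of the shadow of `g` has a protocol of depth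
`≤ min (d ⌈log₂(N+1)⌉ + ⌈log₂ N⌉) (N + ⌈log₂ N⌉)`. Consequently `stub_detProtocol` holds for an
instance `(g, m)` as soon as this quantity is `≤ d^(1-δ) (log(m+N+2))^C + C`, i.e. everywhere
outside the window `polylog(m+N) < d < N^(1/(1-δ))`. [cite: KarchmerWigderson1990, §2] -/
theorem exists_kwTree_shadow [Fintype ι] [Nonempty ι] (g : MvPolynomial ι R) :
    ∃ P : KWTree ι,
      P.SolvesMono (fun a : ι → Bool => decide (∃ mo ∈ g.support, ∀ i ∈ mo.support, a i = true)) ∧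
      P.depth ≤ min (g.totalDegree * Nat.clog 2 (Fintype.card ι + 1) + Nat.clog 2 (Fintype.card ι))
        (Fintype.card ι + Nat.clog 2 (Fintype.card ι)) := by
  have ht : Fintype.card ι ≤ 2 ^ Nat.clog 2 (Fintype.card ι) := Nat.le_pow_clog (by norm_num) _
  by_cases hle : g.totalDegree * Nat.clog 2 (Fintype.card ι + 1) + Nat.clog 2 (Fintype.card ι) ≤
      Fintype.card ι + Nat.clog 2 (Fintype.card ι)
  · rw [min_eq_left hle]
    exact exists_kwTree_shadow_width g _ _ (pow_le_two_pow_mul_clog _ _) ht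
  · rw [min_eq_right (le_of_not_ge hle)]
    exact exists_kwTree_shadow_card g _ ht

/-! ### The registered stub -/

/-- **Registered stub `stub_shadowTrivialProtocol`** of line `det-kw` (crux
stmt-ValiantsHypothesis-17124, skeleton `Cruxes/ShadowFormulaTransfer/Lines/det_kw.lean` after
the cycle-1 reshape; signature verbatim): the trivial shadow protocols over `ℂ`, i.e.
`exists_kwTree_shadow` specialised. [cite: KarchmerWigderson1990, §2] -/
theorem stub_shadowTrivialProtocol :
    ∀ (ι : Type) [Fintype ι] [Nonempty ι] (g : MvPolynomial ι ℂ),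
      ∃ P : KWTree ι,
        P.SolvesMono (fun a : ι → Bool => decide (∃ mo ∈ g.support, ∀ i ∈ mo.support, a i = true)) ∧
        P.depth ≤ min (g.totalDegree * Nat.clog 2 (Fintype.card ι + 1) + Nat.clog 2 (Fintype.card ι))
          (Fintype.card ι + Nat.clog 2 (Fintype.card ι)) :=
  fun _ _ _ g => exists_kwTree_shadow g

end Summit.ValiantsHypothesis.ValiantsHypothesis.Theorems.ShallowShadowsShadowFormulaTransfer

end
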